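import Literature.NumberTheory.EllipticCurves.Greenberg1999.ControlLocalKernelsLayer
import Literature.NumberTheory.EllipticCurves.IwasawaSelmerControlAwayFromPProofs
import Literature.NumberTheory.EllipticCurves.LocalFrobeniusGenerationProofs
import Literature.NumberTheory.EllipticCurves.NeronOggShafarevichLocal
import Literature.NumberTheory.EllipticCurves.PointDivisibilityProofs
import Literature.NumberTheory.EllipticCurves.DivisionPolynomialTorsion
import HarnessLib

/-!
# Inputs for Greenberg's Lemma 3.3 at a good place `v ∤ p`, at every layer: Frobenius-fixed
# `p`-power torsion is finite, and a Frobenius power generates `H_{v,n}` with the inertia group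

`Proofs` file (theorems only: **no definition, no named fact, nothing asserted**), first half of the
discharge of the named fact
`Literature.NumberTheory.EllipticCurves.Greenberg1999.lemma33_localTowerKerPrimary_eq_bot_of_good`
(R. Greenberg, *Iwasawa theory for elliptic curves*, LNM 1716 (1999), §3 Lemma 3.3, second part,
PDF p. 86 of the held copy `book:coatesnd-arithmetic-theory-elliptic-curves`: "If `E` has good
reduction at `v`, then `ker(r_{v_n}) = 0` for all `n`"), completed in the sibling
`ControlLocalKernelsLayerGoodProofs`. Three inputs, each elementary given the tree:

* §0 `range_eq_top_of_divisible_of_finite_ker` (pure algebra): an endomorphism with finite kernel of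
  a divisible `p`-primary abelian group all of whose `p^k`-torsion subgroups are finite is onto
  (Greenberg, proof of Lemma 3.3, p. 87: "`B_v` is divisible … `(γ_v − 1)B_v = B_v`" for
  `B_v ≅ (ℚ_p/ℤ_p)^e`).
* §1 `finite_fixedPoints_frobenius_pow`, `finite_fixedTorsion_localPoints_frobenius_pow`: at a good
  place `v ∤ p` of an elliptic curve `E` over a number field `K`, the `p`-power torsion points of
  `E(K̄_v)` fixed by a positive power `F^M` of a local arithmetic Frobenius are finitely many —
  Greenberg's "`E((F_n)_{v_n})_{p^∞}` is finite" (p. 87) at the unramified layer of degree `M`, read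
  through the injective Frobenius-equivariant reduction map `E(K̄)[p^∞] → Ẽ_v(k̄_v)` of the tree
  (`WeierstrassCurve.exists_reduceTorsionHom`, Silverman *AEC* VII.2.1/VII.3.1(b)), all torsion being
  algebraic (`exists_pointsMapOfEmb_eq_of_nsmul_eq_zero`), and the finiteness of the `φ^M`-fixed points
  of `Ẽ_v(k̄_v)` (coordinates among the roots of `X^{q^M} − X`).
* §2 `exists_frobenius_pow_generate_localSubgroup`: with `I = I_𝔐 ≤ Γ_{K_v}` the inertia group,
  `H_{v,n} = (Γ_{K_v} → Γ_K)⁻¹(Gal(K̄/K_n))` (which contains `I`: a `ℤ_p`-extension is unramified at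
  `v ∤ p`, `ZpExtension.inertia_le_kerSubgroup_holds`) and `M ≥ 1` least with `F^M ∈ H_{v,n}`, every
  open subgroup containing `I` and `F^M` contains `H_{v,n}` — from the tree's
  `exists_eq_frobenius_pow_mul_inertia_mul` (`Γ_{K_v}` is generated by `F` and `I` modulo open
  subgroups; Neukirch, *ANT*, II (9.9)–(9.11)) and division with remainder.

HONEST FRAMING (cell `bsd-2adic`, seat `bsd-2adic-tower-1` GEN 3, HUMAN RULING D-0074 (T1), item
stmt-BirchSwinnertonDyer-19271): tool theorems; nothing booked; no claim beyond the statements.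

## References

* [GreenbergLNM1716] R. Greenberg, LNM 1716 (1999), §3 Lemma 3.3 (PDF pp. 86–88).
* [SilvermanAEC2009] J. H. Silverman, *AEC*, 2nd ed. (2009), Prop. VII.3.1(b), VII.2.1,
  Cor. III.6.4(b), §VIII.2.
* [NeukirchANT1999] J. Neukirch, *Algebraic Number Theory* (1999), Ch. II §9 (9.9)–(9.11).

## Design

No definitions, no named facts; `noncomputable section`, `open scoped Classical NNReal`, one universe
`u`; inside `namespace Literature.…` the root namespaces are opened as `_root_.WeierstrassCurve` etc.
(lean/CONVENTIONS.md §2). Axioms: `propext`, `Classical.choice`, `Quot.sound`.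
-/

noncomputable section

open scoped Classical NNReal

open NumberField IsDedekindDomain Field

universe u

namespace Literature.NumberTheory.EllipticCurves.Greenberg1999

open Literature.NumberTheory.EllipticCurves Literature.NumberTheory.GaloisRepresentations
  Literature.NumberTheory.EllipticCurves.FormalGroupChart Literature.NumberTheory.EllipticCurves.ResKernel
  _root_.Field _root_.IsDedekindDomain.HeightOneSpectrum _root_.WeierstrassCurve

/-! ## §0 Pure algebra: a divisible `p`-primary group with finite `p^k`-torsion has no proper
endomorphic image with finite kernel -/

/-- **An endomorphism with finite kernel of a divisible `p`-primary group all of whose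
`p^k`-torsion subgroups are finite is surjective.** Let `B` be an abelian group in which every
element is killed by a power of `p`, every `b` is `p • c` for some `c`, and every `B[p^k]` is
finite; let `φ` be an endomorphism with finite kernel, `#ker φ ≤ p^a`. On the finite `φ`-stable
subgroup `B[p^N]` the index of `φ(B[p^N])` is `#ker(φ|B[p^N]) ≤ #ker φ`, so the finite `p`-group
`B[p^N]/φ(B[p^N])` is killed by `p^{#ker φ}`; writing `b = p^{#ker φ} • z` (divisibility) with
`z ∈ B[p^N]` gives `b ∈ φ(B)`. (For `B ≅ (ℚ_p/ℤ_p)^r` this is "an isogeny of a divisible group is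
onto"; Greenberg, LNM 1716, proof of Lemma 3.3, p. 87: "`B_v` is divisible … `(γ_v − 1)B_v = B_v`".)
[cite: GreenbergLNM1716, §3 Lemma 3.3 (proof, p. 87)] -/
theorem range_eq_top_of_divisible_of_finite_ker {B : Type*} [AddCommGroup B] {p : ℕ}
    (hp : p.Prime) (φ : B →+ B) (hprim : ∀ b : B, ∃ n : ℕ, p ^ n • b = 0)
    (hdiv : ∀ b : B, ∃ c : B, p • c = b)
    (hfin : ∀ n : ℕ, Finite (nsmulAddMonoidHom (p ^ n) : B →+ B).ker) [Finite φ.ker] :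
    φ.range = ⊤ := by
  classical
  -- notation: `K₀ = #ker φ`, `B[p^N]`
  set K₀ : ℕ := Nat.card φ.ker with hK₀
  have hK₀pos : 0 < K₀ := Nat.card_pos
  -- iterated divisibility
  have hdivk : ∀ (k : ℕ) (b : B), ∃ c : B, p ^ k • c = b := by
    intro k
    induction k with
    | zero => exact fun b ↦ ⟨b, by rw [pow_zero, one_smul]⟩
    | succ k ih =>
      intro b
      obtain ⟨c, hc⟩ := ih b
      obtain ⟨d, hd⟩ := hdiv c
      exact ⟨d, by rw [pow_succ, mul_smul, hd, hc]⟩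
  -- every element of `B[p^N] / φ(B[p^N])` is killed by `p ^ K₀`
  have key : ∀ (N : ℕ) (z : B), p ^ N • z = 0 → p ^ K₀ • z ∈ φ.range := by
    intro N z hz
    let BN : AddSubgroup B := (nsmulAddMonoidHom (p ^ N) : B →+ B).ker
    haveI : Finite BN := hfin N
    have hφN : ∀ b ∈ BN, φ b ∈ BN := by
      intro b hb
      change (nsmulAddMonoidHom (p ^ N) : B →+ B) (φ b) = 0
      have hb' : (p ^ N) • b = 0 := hb
      rw [nsmulAddMonoidHom_apply, ← map_nsmul, hb', map_zero]
    let φN : BN →+ BN := (φ.comp BN.subtype).codRestrict BN fun b ↦ hφN b b.2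
    -- `#BN = #ker φN * #range φN` and `#ker φN ≤ K₀`
    have hkerle : Nat.card φN.ker ≤ K₀ := by
      refine Nat.card_le_card_of_injective (fun x ↦ (⟨((x : BN) : B), ?_⟩ : φ.ker)) ?_
      · have hx : φN (x : BN) = 0 := (AddMonoidHom.mem_ker).mp x.2
        exact (AddMonoidHom.mem_ker).mpr (congrArg (fun y : BN ↦ (y : B)) hx)
      · intro x y hxy
        apply Subtype.ext; apply Subtype.ext
        exact congrArg (fun y : φ.ker ↦ (y : B)) hxy
    let Q := BN ⧸ φN.range
    haveI : Finite Q := inferInstance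
    have hcardQ : Nat.card Q ≤ K₀ := by
      have h1 : Nat.card BN = Nat.card φN.ker * Nat.card φN.range := by
        rw [← Nat.card_congr (QuotientAddGroup.quotientKerEquivRange φN).toEquiv]
        exact (AddSubgroup.card_eq_card_quotient_mul_card_addSubgroup φN.ker).trans (mul_comm _ _)
      have h2 : Nat.card BN = Nat.card Q * Nat.card φN.range :=
        AddSubgroup.card_eq_card_quotient_mul_card_addSubgroup φN.range
      have hr : 0 < Nat.card φN.range := Nat.card_pos
      have : Nat.card Q * Nat.card φN.range ≤ K₀ * Nat.card φN.range := by
        rw [← h2, h1]; exact Nat.mul_le_mul_right _ hkerle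
      exact Nat.le_of_mul_le_mul_right this hr
    -- the class of `z` in `Q` has order `p^j ≤ K₀`, so `p^K₀` kills it
    have hzN : z ∈ BN := by
      change (nsmulAddMonoidHom (p ^ N) : B →+ B) z = 0
      rw [nsmulAddMonoidHom_apply]; exact hz
    set q : Q := QuotientAddGroup.mk (⟨z, hzN⟩ : BN) with hq
    have hqN : p ^ N • q = 0 := by
      rw [hq, ← QuotientAddGroup.mk_nsmul]
      have : p ^ N • (⟨z, hzN⟩ : BN) = 0 := Subtype.ext (by
        rw [AddSubgroupClass.coe_nsmul]; exact hz)
      rw [this, QuotientAddGroup.mk_zero]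
    have hord : addOrderOf q ∣ p ^ N := addOrderOf_dvd_of_nsmul_eq_zero hqN
    obtain ⟨j, -, hj⟩ := (Nat.dvd_prime_pow hp).mp hord
    have hjle : p ^ j ≤ K₀ := by
      rw [← hj]
      exact (Nat.le_of_dvd Nat.card_pos (addOrderOf_dvd_natCard q)).trans hcardQ
    have hjK : j ≤ K₀ := (Nat.lt_pow_self hp.one_lt).le.trans hjle
    have hqK : p ^ K₀ • q = 0 := by
      obtain ⟨d, hd⟩ := Nat.exists_eq_add_of_le hjK
      rw [hd, pow_add, mul_comm, mul_smul, ← hj, addOrderOf_nsmul_eq_zero, smul_zero]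
    -- unpack: `p^K₀ • z ∈ φ(BN) ⊆ φ(B)`
    rw [hq, ← QuotientAddGroup.mk_nsmul, QuotientAddGroup.eq_zero_iff] at hqK
    obtain ⟨y, hy⟩ := hqK
    refine ⟨(y : B), ?_⟩
    have := congrArg (fun t : BN ↦ (t : B)) hy
    simpa [φN, AddSubgroupClass.coe_nsmul] using this
  -- conclusion
  rw [eq_top_iff]
  intro b _
  obtain ⟨n, hn⟩ := hprim b
  obtain ⟨z, hz⟩ := hdivk K₀ b
  have hzN : p ^ (K₀ + n) • z = 0 := by rw [pow_add, mul_comm, mul_smul, hz, hn]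
  rw [← hz]
  exact key (K₀ + n) z hzN


/-! ## §1 The `p`-power torsion of `E(K̄_v)` fixed by a power of a local Frobenius is finite
(good reduction at `v ∤ p`: reduction to `Ẽ_v(k̄_v)` and the finitely many `φ^M`-fixed points) -/

section FrobeniusFixed

variable {K : Type u} [Field K] [NumberField K] (W : WeierstrassCurve K) {v : HeightOneSpectrum (𝓞 K)}
  {p : ℕ} [Fact p.Prime]

/-- **Points of `Ẽ(k̄)` fixed by a positive power of the `q`-Frobenius are finitely many**: for a
Weierstrass cubic `V` over a finite field `k` with `q = #k` and `φ ∈ Γ_k` acting on `k̄` by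
`x ↦ x^q`, the points of `V(k̄)` fixed by `φ^M` (`M ≥ 1`) have coordinates among the finitely
many roots of `X^{q^M} − X` (they are the points over `𝔽_{q^M}`). [folklore] -/
private theorem finite_fixedPoints_frobenius_pow {k : Type u} [Field k] [Finite k] (V : WeierstrassCurve k)
    {φ : absoluteGaloisGroup k} (hφ : ∀ x : AlgebraicClosure k, φ • x = x ^ Nat.card k)
    {M : ℕ} (hM : 0 < M) :
    Finite {Q : V.geomPoints // φ ^ M • Q = Q} := by
  classical
  set q : ℕ := Nat.card k with hq
  have hq1 : 1 < q := Finite.one_lt_card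
  -- `φ^n` raises coordinates to the power `q^n`
  have hφM : ∀ (n : ℕ) (x : AlgebraicClosure k), (φ ^ n) • x = x ^ (q ^ n) := by
    intro n
    induction n with
    | zero => intro x; rw [pow_zero, one_smul, pow_zero, pow_one]
    | succ n ih =>
      intro x
      rw [pow_succ, mul_smul, hφ, smul_pow', ih, ← pow_mul, ← pow_succ]
  -- the finite set of roots of `X^{q^M} - X`
  set P : Polynomial (AlgebraicClosure k) := Polynomial.X ^ (q ^ M) - Polynomial.X with hP
  have hqM : 1 < q ^ M := Nat.one_lt_pow hM.ne' hq1
  have hP0 : P ≠ 0 := by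
    rw [hP]
    exact FiniteField.X_pow_card_sub_X_ne_zero (AlgebraicClosure k) hqM
  have hSfin : Set.Finite {x : AlgebraicClosure k | P.IsRoot x} := Polynomial.finite_setOf_isRoot hP0
  have hroot : ∀ x : AlgebraicClosure k, (φ ^ M) • x = x → P.IsRoot x := by
    intro x hx
    rw [hφM] at hx
    rw [hP, Polynomial.IsRoot, Polynomial.eval_sub, Polynomial.eval_pow, Polynomial.eval_X, hx,
      sub_self]
  let S : Type u := {x : AlgebraicClosure k // P.IsRoot x}
  haveI : Finite S := hSfin.to_subtype
  -- the coordinates of a point, as an element of `Option (K̄ × K̄)`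
  let c : V.geomPoints → Option (AlgebraicClosure k × AlgebraicClosure k) := fun Q ↦
    match (Q : (V.baseChange (AlgebraicClosure k)).toAffine.Point) with
    | .zero => none
    | .some x y _ => some (x, y)
  have hc : Function.Injective c := by
    intro Q Q' h
    rcases hQ : (Q : (V.baseChange (AlgebraicClosure k)).toAffine.Point) with _ | ⟨x, y, hxy⟩ <;>
      rcases hQ' : (Q' : (V.baseChange (AlgebraicClosure k)).toAffine.Point) with _ | ⟨x', y', hxy'⟩ <;>
      simp only [c, hQ, hQ', reduceCtorEq, Option.some.injEq, Prod.mk.injEq] at h ⊢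
    obtain ⟨rfl, rfl⟩ := h
    rfl
  -- coordinates of a `φ^M`-fixed point are roots of `P`
  set R : Set (AlgebraicClosure k) := {x | P.IsRoot x} with hR
  have hT : Set.Finite (insert none ((fun xy : AlgebraicClosure k × AlgebraicClosure k ↦ some xy) ''
      (R ×ˢ R))) := ((hSfin.prod hSfin).image _).insert none
  have hsub : c '' {Q : V.geomPoints | φ ^ M • Q = Q} ⊆
      insert none ((fun xy : AlgebraicClosure k × AlgebraicClosure k ↦ some xy) '' (R ×ˢ R)) := by
    rintro _ ⟨Q, hQfix, rfl⟩
    change φ ^ M • Q = Q at hQfix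
    change WeierstrassCurve.Affine.Point.map _ (Q : (V.baseChange (AlgebraicClosure k)).toAffine.Point) = _ at hQfix
    rcases hQ : (Q : (V.baseChange (AlgebraicClosure k)).toAffine.Point) with _ | ⟨x, y, hxy'⟩
    · simp [c]
    · rw [hQ, WeierstrassCurve.Affine.Point.map_some] at hQfix
      simp only [WeierstrassCurve.Affine.Point.some.injEq] at hQfix
      simp only [c, Set.mem_insert_iff, reduceCtorEq, Set.mem_image, Set.mem_prod,
        Option.some.injEq, exists_eq_right, false_or]
      exact ⟨hroot x hQfix.1, hroot y hQfix.2⟩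
  exact ((hT.subset hsub).of_finite_image hc.injOn).to_subtype

/-- **At a good place `v ∤ p`, the `p`-power torsion points of `E(K̄_v)` fixed by a positive power
`F^M` of a local arithmetic Frobenius `F` are finitely many.** Every `p`-power torsion point of
`E(K̄_v)` is `ι_* P₀` for a `p`-power torsion point `P₀ ∈ E(K̄)` (all torsion is algebraic,
`exists_pointsMapOfEmb_eq_of_nsmul_eq_zero`), `F^M • ι_* P₀ = ι_* ((F|_{K̄})^M • P₀)`
(`pointsMapOfEmb_smul`), and the injective, Frobenius-equivariant reduction map
`E(K̄)[p^∞] → Ẽ_v(k̄_v)` (`exists_reduceTorsionHom`: Silverman VII.2.1, VII.3.1(b)) carries the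
`(F|_{K̄})^M`-fixed points into the finitely many `φ^M`-fixed points of `Ẽ_v(k̄_v)`
(`finite_fixedPoints_frobenius_pow`). This is Greenberg's "`E((F_n)_{v_n})_{p^∞}` is finite" at
the unramified layer of degree `M` (LNM 1716, proof of Lemma 3.3, p. 87), read through the reduction.
[cite: GreenbergLNM1716, §3 Lemma 3.3 (proof, p. 87)] [cite: SilvermanAEC2009, Prop. VII.3.1(b)] -/
theorem finite_fixedTorsion_localPoints_frobenius_pow [W.IsElliptic] (hpv : (p : 𝓞 K) ∉ v.asIdeal)
    (hv : W.HasGoodReductionAt v) {𝔐 : Ideal (localAbsIntegers v)} (h𝔐 : 𝔐 ∈ v.localPrimesAbove)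
    {F : absoluteGaloisGroup (v.adicCompletion K)}
    (hF : IsArithFrobAt (v.adicCompletionIntegers K) F 𝔐) {M : ℕ} (hM : 0 < M) :
    Finite {P : localPoints W (v.adicCompletion K) //
      F ^ M • P = P ∧ ∃ k : ℕ, p ^ k • P = 0} := by
  classical
  -- the residue field, its Frobenius, an embedding `ι : K̄ → K̄_v`, the reduction map
  haveI : Finite (IsLocalRing.ResidueField (v.adicCompletionIntegers K)) :=
    finite_residueField_adicCompletionIntegers K v
  obtain ⟨φ, hφ⟩ := WeierstrassCurve.exists_frobenius_absoluteGaloisGroup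
    (IsLocalRing.ResidueField (v.adicCompletionIntegers K))
  let ι : AlgebraicClosure K →ₐ[K] AlgebraicClosure (v.adicCompletion K) :=
    closureEmb (K := K) (v.adicCompletion K)
  obtain ⟨f, hf, hfF⟩ := W.exists_reduceTorsionHom (ℓ := p) hpv hv h𝔐 ι hF hφ
  haveI := finite_fixedPoints_frobenius_pow (W.reductionAt v) hφ hM
  -- iterate the equivariance
  set σ : absoluteGaloisGroup K := resGalOfEmb ι F with hσ
  have hfFM : ∀ (n : ℕ) (P : W.geomPrimaryTorsion p), f (σ ^ n • P) = φ ^ n • f P := by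
    intro n
    induction n with
    | zero => intro P; rw [pow_zero, pow_zero, one_smul, one_smul]
    | succ n ih => intro P; rw [pow_succ, pow_succ, mul_smul, mul_smul, ih, hfF]
  -- every `F^M`-fixed `p`-power torsion local point comes from a `σ^M`-fixed `P₀ ∈ E(K̄)[p^∞]`
  have key : ∀ P : {P : localPoints W (v.adicCompletion K) // F ^ M • P = P ∧ ∃ k : ℕ, p ^ k • P = 0},
      ∃ P₀ : W.geomPrimaryTorsion p, pointsMapOfEmb W ι (P₀ : W.geomPoints) = P.1 ∧
        φ ^ M • f P₀ = f P₀ := by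
    rintro ⟨P, hPF, k, hk⟩
    have hpk : (p ^ k : ℕ) ≠ 0 := pow_ne_zero k (Fact.out : p.Prime).ne_zero
    obtain ⟨P₁, hP₁, hP₁P⟩ := exists_pointsMapOfEmb_eq_of_nsmul_eq_zero W ι hpk hk
    let P₀ : W.geomPrimaryTorsion p := ⟨P₁, (AddCommGroup.mem_primaryComponent).mpr ⟨k, hP₁⟩⟩
    have hfix : σ ^ M • P₀ = P₀ := by
      apply Subtype.ext
      rw [primaryComponent.coe_smul]
      apply pointsMapOfEmb_injective W ι
      change pointsMapOfEmb W ι (σ ^ M • P₁) = pointsMapOfEmb W ι P₁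
      rw [hσ, ← map_pow, pointsMapOfEmb_smul, hP₁P, hPF]
    exact ⟨P₀, hP₁P, by rw [← hfFM M, hfix]⟩
  choose g hgP hgfix using key
  refine Finite.of_injective (fun P ↦ (⟨f (g P), hgfix P⟩ :
    {Q : (W.reductionAt v).geomPoints // φ ^ M • Q = Q})) fun P P' h ↦ ?_
  have h1 : f (g P) = f (g P') := congrArg Subtype.val h
  have h2 : g P = g P' := hf h1
  apply Subtype.ext
  rw [← hgP P, ← hgP P', h2]

end FrobeniusFixed


/-! ## §2 A positive power of a local Frobenius generates `H_{v,n}` together with the inertia group -/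

section Generator

variable {K : Type u} [Field K] [NumberField K] {v : HeightOneSpectrum (𝓞 K)}
  {p : ℕ} [Fact p.Prime] (κ : ZpExtension K p)

/-- **`H_{v,n}` is topologically generated by the inertia group and a positive power of a local
Frobenius.** Let `v ∤ p`, `𝔐` the prime of `\bar 𝓞_v`, `I = I_𝔐 ≤ Γ_{K_v}` its inertia group, `F` a
local arithmetic Frobenius, and `H_{v,n} = (Γ_{K_v} → Γ_K)⁻¹(Gal(K̄/K_n))` (open, and `⊇ I` since a
`ℤ_p`-extension is unramified at `v ∤ p`, `ZpExtension.inertia_le_kerSubgroup_holds`). With `M ≥ 1`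
the least positive integer such that `F^M ∈ H_{v,n}`: every open subgroup `U ≥ I` containing `F^M`
contains `H_{v,n}`. Proof: `Γ_{K_v}` is generated by `F` and `I` modulo every open subgroup
(`exists_eq_frobenius_pow_mul_inertia_mul`: `x = F^a τ u`, `τ ∈ I`, `u ∈ U ∩ H_{v,n}`); for `x ∈ H_{v,n}`
this forces `F^a ∈ H_{v,n}`, hence `M ∣ a` (division with remainder and minimality of `M`), so
`F^a ∈ U` and `x ∈ U`. (Classically: `Γ_{K_v}/I ≅ Ẑ` is procyclic on the Frobenius, and
`H_{v,n}/I` is its subgroup of index `M`.) [cite: NeukirchANT1999, Ch. II §9 Prop. (9.9)–(9.11)] -/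
theorem exists_frobenius_pow_generate_localSubgroup (hpv : (p : 𝓞 K) ∉ v.asIdeal)
    {𝔐 : Ideal (localAbsIntegers v)} (h𝔐 : 𝔐 ∈ v.localPrimesAbove)
    {F : absoluteGaloisGroup (v.adicCompletion K)}
    (hF : IsArithFrobAt (v.adicCompletionIntegers K) F 𝔐) (n : ℕ) :
    ∃ M : ℕ, 0 < M ∧ F ^ M ∈ localSubgroup (κ.layerSubgroup n) (v.adicCompletion K) ∧
      ∀ U : Subgroup (absoluteGaloisGroup (v.adicCompletion K)),
        IsOpen (U : Set (absoluteGaloisGroup (v.adicCompletion K))) →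
        𝔐.inertia (absoluteGaloisGroup (v.adicCompletion K)) ≤ U → F ^ M ∈ U →
        localSubgroup (κ.layerSubgroup n) (v.adicCompletion K) ≤ U := by
  classical
  -- notation
  let G : Type u := absoluteGaloisGroup (v.adicCompletion K)
  set Hn : Subgroup G := localSubgroup (κ.layerSubgroup n) (v.adicCompletion K) with hHn
  set I : Subgroup G := 𝔐.inertia G with hIdef
  have hHnopen : IsOpen (Hn : Set G) := isOpen_localSubgroup_layerSubgroup (v.adicCompletion K) κ n
  -- `I ≤ H_{v,∞} ≤ H_{v,n}`
  have hI : I ≤ Hn := fun σ hσ ↦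
    WeierstrassCurve.localSubgroup_ker_le_layer κ (v.adicCompletion K) n
      ((mem_localSubgroup_iff _ _ σ).mpr
        (ZpExtension.inertia_le_kerSubgroup_holds K p κ hpv (primeBelow_mem_primesAbove h𝔐)
          (v.resGalOfEmb_mem_inertia_primeBelow (closureEmb (K := K) (v.adicCompletion K)) 𝔐 hσ)))
  -- some positive power of `F` lies in `H_{v,n}`
  have hex : ∃ M : ℕ, 0 < M ∧ F ^ M ∈ Hn := by
    obtain ⟨a, τ, u, hτ, hu, h⟩ := exists_eq_frobenius_pow_mul_inertia_mul v h𝔐 hF hHnopen F⁻¹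
    refine ⟨a + 1, Nat.succ_pos a, ?_⟩
    have e : F ^ (a + 1) = u⁻¹ * τ⁻¹ := by
      have h1 : F * (F ^ a * τ * u) = 1 := by rw [← h, mul_inv_cancel]
      calc F ^ (a + 1) = F * F ^ a := pow_succ' F a
        _ = F * (F ^ a * τ * u) * (u⁻¹ * τ⁻¹) := by group
        _ = u⁻¹ * τ⁻¹ := by rw [h1, one_mul]
    rw [e]
    exact Hn.mul_mem (Hn.inv_mem hu) (Hn.inv_mem (hI hτ))
  let M : ℕ := Nat.find hex
  have hM : 0 < M ∧ F ^ M ∈ Hn := Nat.find_spec hex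
  have hMmin : ∀ r : ℕ, 0 < r → F ^ r ∈ Hn → M ≤ r := fun r hr hrmem ↦ Nat.find_min' hex ⟨hr, hrmem⟩
  -- `F^a ∈ H_{v,n}` forces `M ∣ a`
  have hdvd : ∀ a : ℕ, F ^ a ∈ Hn → M ∣ a := by
    intro a ha
    have hr : F ^ (a % M) ∈ Hn := by
      have e : F ^ a = (F ^ M) ^ (a / M) * F ^ (a % M) := by
        rw [← pow_mul, ← pow_add, Nat.div_add_mod a M]
      have : F ^ (a % M) = ((F ^ M) ^ (a / M))⁻¹ * F ^ a := by
        rw [e, inv_mul_cancel_left]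
      rw [this]
      exact Hn.mul_mem (Hn.inv_mem (Hn.pow_mem hM.2 _)) ha
    by_contra hnd
    have hpos : 0 < a % M := Nat.pos_of_ne_zero fun h0 ↦ hnd (Nat.dvd_of_mod_eq_zero h0)
    exact absurd (hMmin _ hpos hr) (not_le.mpr (Nat.mod_lt a hM.1))
  refine ⟨M, hM.1, hM.2, fun U hU hIU hFU x hx ↦ ?_⟩
  -- `x = F^a τ u` with `τ ∈ I`, `u ∈ U ∩ H_{v,n}`
  obtain ⟨a, τ, u, hτ, hu, rfl⟩ :=
    exists_eq_frobenius_pow_mul_inertia_mul v h𝔐 hF (U := U ⊓ Hn) (hU.inter hHnopen) x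
  have hFa : F ^ a ∈ Hn := by
    have e : F ^ a = F ^ a * τ * u * u⁻¹ * τ⁻¹ := by group
    rw [e]
    exact Hn.mul_mem (Hn.mul_mem hx (Hn.inv_mem (Subgroup.mem_inf.mp hu).2)) (Hn.inv_mem (hI hτ))
  obtain ⟨c, hc⟩ := hdvd a hFa
  rw [hc, pow_mul]
  exact U.mul_mem (U.mul_mem (U.pow_mem hFU c) (hIU hτ)) (Subgroup.mem_inf.mp hu).1

end Generator


end Literature.NumberTheory.EllipticCurves.Greenberg1999
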